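import Summits.CriticalPhenomena.PercolationContinuityZ3.Theorems.PercNearOneGluingNoHeavyQuantIndepBlobFarMin
import HarnessLib

/-!
# QUANT lane R8, FAR for independent blobs (IV): the thinning identity (doubling coupling) and the reflection count

builds on p205010 (kernel theorem, internal audit signed; external expert review pending)

Support file (`--supports stmt-CriticalPhenomena-4575`), QUANT lane census-2 (gen 46); memo
`run/shared/lean/prim/quant/prim-quant-census-2-g46/HALF-ROW-PROOF.md`.  Two combinatorial tools for HALF-ROW
(`…QuantIndepBlobHalfRow.lean`: `EW > 2y − 3 ⟹ P(W ≥ y) ≥ (min gate)/2`), in the vocabulary of `…QuantIndepBlobMoments/…FarMin`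
(configurations `s : Finset κ`, product-Bernoulli weight `∏ k, (if k ∈ s then p k else 1 − p k)`):

* `sum_weight_thin` — THINNING IDENTITY (doubling coupling in algebraic form): for gates factorised as `q k · θ k`,
  `∑_s w_{qθ}(s) F(s) = ∑_S w_q(S) ∑_{t ⊆ S} (∏_{k∈S} (θ k if k ∈ t else 1 − θ k)) F(t)` — draw `S` with the `q`-weights, then keep each
  `k ∈ S` independently with probability `θ k`;
* `card_powerset_le_four_mul_card_heavy` / `quarter_le_sum_powerset_heavy` — REFLECTION COUNT: for integer sizes `a k ≥ 1`, `y ≥ 2` and a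
  finset `S` with `∑_{k∈S} a k ≥ 2y − 2`, at least a quarter of the subsets `t ⊆ S` have `∑_{k∈t} a k ≥ y` (every `t` lies in
  `H ∪ c(H) ∪ τ(H) ∪ τ(c(H))`, `H` the heavy subsets, `c` the complement in `S`, `τ` the toggle of a fixed `k₀ ∈ S`); i.e. with fair coins on
  `S` the heavy subsets carry mass `≥ 1/4`.
No sorries; standard axioms; no new definitions.
-/

namespace Summit.CriticalPhenomena.PercolationContinuityZ3.Theorems

namespace Quant

namespace IndepBlob

open Finset

variable {κ : Type*} [Fintype κ] [DecidableEq κ]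

/-! ### 1. The thinning identity (doubling coupling, algebraic form) -/

omit [Fintype κ] in
/-- Product formula on a finset: `∑_{U ⊆ S} ∏_{k ∈ S} (if k ∈ U then g k else h k) = ∏_{k ∈ S} (g k + h k)`. [folklore] -/
theorem sum_powerset_prod_ite_mem (S : Finset κ) (g h : κ → ℝ) :
    ∑ U ∈ S.powerset, ∏ k ∈ S, (if k ∈ U then g k else h k) = ∏ k ∈ S, (g k + h k) := by
  rw [Finset.prod_add]
  refine Finset.sum_congr rfl fun U hU => ?_
  rw [Finset.mem_powerset] at hU
  rw [Finset.prod_ite]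
  congr 1
  · refine Finset.prod_congr ?_ fun _ _ => rfl
    ext k
    simp only [Finset.mem_filter]
    exact ⟨fun h => h.2, fun h => ⟨hU h, h⟩⟩
  · refine Finset.prod_congr ?_ fun _ _ => rfl
    ext k
    simp only [Finset.mem_filter, Finset.mem_sdiff]

/-- **Thinning identity (doubling coupling).**  For gates factorised as `q k · θ k`, the `qθ`-product weight of a configuration `s` is
obtained by first drawing a set `S` with the `q`-product weight and then keeping each `k ∈ S` independently with probability `θ k`:
`∑_s w_{qθ}(s) F(s) = ∑_S w_q(S) ∑_{t ⊆ S} (∏_{k∈S} (θ k if k ∈ t else 1 − θ k)) F(t)` for every `F`. [folklore] -/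
theorem sum_weight_thin (q θ : κ → ℝ) (F : Finset κ → ℝ) :
    ∑ s : Finset κ, (∏ k, if k ∈ s then q k * θ k else 1 - q k * θ k) * F s =
      ∑ S : Finset κ, (∏ k, if k ∈ S then q k else 1 - q k) *
        ∑ t ∈ S.powerset, (∏ k ∈ S, if k ∈ t then θ k else 1 - θ k) * F t := by
  -- exchange the two sums on the right
  have hex : ∑ S : Finset κ, (∏ k, if k ∈ S then q k else 1 - q k) *
        ∑ t ∈ S.powerset, (∏ k ∈ S, if k ∈ t then θ k else 1 - θ k) * F t =
      ∑ t : Finset κ, ∑ S ∈ (Finset.univ : Finset (Finset κ)).filter (fun S => t ⊆ S),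
        (∏ k, if k ∈ S then q k else 1 - q k) * ((∏ k ∈ S, if k ∈ t then θ k else 1 - θ k) * F t) := by
    simp_rw [Finset.mul_sum]
    refine Finset.sum_comm' fun S t => ?_
    simp only [Finset.mem_univ, true_and, and_true, Finset.mem_powerset, Finset.mem_filter]
  rw [hex]
  refine Finset.sum_congr rfl fun t _ => ?_
  -- for a fixed `t`, sum over `S ⊇ t`, reindexed by `U = S \ t ⊆ tᶜ`
  have hre : ∑ S ∈ (Finset.univ : Finset (Finset κ)).filter (fun S => t ⊆ S),
        (∏ k, if k ∈ S then q k else 1 - q k) * ((∏ k ∈ S, if k ∈ t then θ k else 1 - θ k) * F t) =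
      ∑ U ∈ (tᶜ).powerset,
        (∏ k, if k ∈ t ∪ U then q k else 1 - q k) * ((∏ k ∈ t ∪ U, if k ∈ t then θ k else 1 - θ k) * F t) := by
    refine Finset.sum_nbij' (fun S => S \ t) (fun U => t ∪ U) (fun S hS => ?_) (fun U hU => ?_) (fun S hS => ?_)
      (fun U hU => ?_) (fun S hS => ?_)
    · rw [Finset.mem_powerset]
      intro k hk
      rw [Finset.mem_sdiff] at hk
      exact Finset.mem_compl.2 hk.2
    · rw [Finset.mem_filter]
      exact ⟨Finset.mem_univ _, Finset.subset_union_left⟩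
    · rw [Finset.mem_filter] at hS
      exact Finset.union_sdiff_of_subset hS.2
    · rw [Finset.mem_powerset] at hU
      have hdis : Disjoint t U := by
        rw [Finset.disjoint_left]
        intro k hk hkU
        exact Finset.mem_compl.1 (hU hkU) hk
      exact Finset.union_sdiff_cancel_left hdis
    · rw [Finset.mem_filter] at hS
      rw [Finset.union_sdiff_of_subset hS.2]
  rw [hre]
  -- the summand for `U ⊆ tᶜ`
  have hsummand : ∀ U ∈ (tᶜ).powerset,
      (∏ k, if k ∈ t ∪ U then q k else 1 - q k) * ((∏ k ∈ t ∪ U, if k ∈ t then θ k else 1 - θ k) * F t) =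
        F t * (∏ k ∈ t, q k * θ k) * ∏ k ∈ tᶜ, (if k ∈ U then q k * (1 - θ k) else 1 - q k) := by
    intro U hU
    rw [Finset.mem_powerset] at hU
    have hdis : Disjoint t U := by
      rw [Finset.disjoint_left]
      intro k hk hkU
      exact Finset.mem_compl.1 (hU hkU) hk
    -- split the `q`-weight over `t` and `tᶜ`
    have hq : (∏ k, if k ∈ t ∪ U then q k else 1 - q k) =
        (∏ k ∈ t, q k) * ∏ k ∈ tᶜ, (if k ∈ U then q k else 1 - q k) := by
      rw [← Finset.prod_mul_prod_compl t]
      congr 1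
      · refine Finset.prod_congr rfl fun k hk => ?_
        rw [if_pos (Finset.mem_union_left U hk)]
      · refine Finset.prod_congr rfl fun k hk => ?_
        have hkt : k ∉ t := Finset.mem_compl.1 hk
        have : (k ∈ t ∪ U) ↔ k ∈ U := by
          rw [Finset.mem_union]
          exact ⟨fun h => h.resolve_left hkt, Or.inr⟩
        simp only [this]
    -- the `θ`-weight of `t` inside `t ∪ U`
    have hθ : (∏ k ∈ t ∪ U, if k ∈ t then θ k else 1 - θ k) =
        (∏ k ∈ t, θ k) * ∏ k ∈ tᶜ, (if k ∈ U then 1 - θ k else 1) := by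
      rw [Finset.prod_union hdis]
      congr 1
      · exact Finset.prod_congr rfl fun k hk => by rw [if_pos hk]
      · rw [Finset.prod_ite_mem, Finset.inter_eq_right.2 hU]
        refine Finset.prod_congr rfl fun k hk => ?_
        rw [if_neg (Finset.disjoint_right.1 hdis hk)]
    rw [hq, hθ]
    have h3 : (∏ k ∈ tᶜ, (if k ∈ U then q k else 1 - q k)) * ∏ k ∈ tᶜ, (if k ∈ U then 1 - θ k else 1) =
        ∏ k ∈ tᶜ, (if k ∈ U then q k * (1 - θ k) else 1 - q k) := by
      rw [← Finset.prod_mul_distrib]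
      refine Finset.prod_congr rfl fun k _ => ?_
      split_ifs <;> ring
    rw [← h3, Finset.prod_mul_distrib]
    ring
  rw [Finset.sum_congr rfl hsummand, ← Finset.mul_sum, sum_powerset_prod_ite_mem]
  -- reassemble the `qθ`-weight of `t`
  have hw : (∏ k, if k ∈ t then q k * θ k else 1 - q k * θ k) =
      (∏ k ∈ t, q k * θ k) * ∏ k ∈ tᶜ, (q k * (1 - θ k) + (1 - q k)) := by
    rw [← Finset.prod_mul_prod_compl t]
    congr 1
    · exact Finset.prod_congr rfl fun k hk => by rw [if_pos hk]
    · refine Finset.prod_congr rfl fun k hk => ?_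
      rw [if_neg (Finset.mem_compl.1 hk)]
      ring
  rw [hw]
  ring

/-! ### 2. The reflection count: a quarter of the subsets of a set of total size `≥ 2y − 2` have size `≥ y` -/

omit [Fintype κ] in
/-- **Reflection count.**  Integer sizes `a k ≥ 1`, a finset `S` with `∑_{k∈S} a k ≥ 2y − 2`, `y ≥ 2`.  Then at least a quarter of the
subsets `t ⊆ S` are heavy (`∑_{k∈t} a k ≥ y`): with `H` the heavy subsets, `c t = S ∖ t` and `τ` = toggling a fixed `k₀ ∈ S`, every
`t ⊆ S` lies in `H ∪ c(H) ∪ τ(H) ∪ τ(c(H))` — if `t` and `c t` are both light then both have size exactly `y − 1`, and toggling `k₀` makes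
`t` (if `k₀ ∉ t`) or `c(τ t)` (if `k₀ ∈ t`) heavy.  This is the reflection `η ↦ 1 − η` for fair coins plus the bound `1/2` on an atom. [this work] -/
theorem card_powerset_le_four_mul_card_heavy (S : Finset κ) (a : κ → ℕ) (ha : ∀ k, 1 ≤ a k) (y : ℕ)
    (hA : 2 * y ≤ ∑ k ∈ S, a k + 2) (hy : 2 ≤ y) :
    S.powerset.card ≤ 4 * (S.powerset.filter (fun t => y ≤ ∑ k ∈ t, a k)).card := by
  -- `S` is nonempty
  have hSne : S.Nonempty := by
    rw [Finset.nonempty_iff_ne_empty]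
    rintro rfl
    rw [Finset.sum_empty] at hA
    omega
  obtain ⟨k₀, hk₀⟩ := hSne
  set H := S.powerset.filter (fun t => y ≤ ∑ k ∈ t, a k) with hH
  set c : Finset κ → Finset κ := fun t => S \ t with hc
  set τ : Finset κ → Finset κ := fun t => if k₀ ∈ t then t.erase k₀ else insert k₀ t with hτ
  have hcc : ∀ t, t ⊆ S → c (c t) = t := fun t ht => Finset.sdiff_sdiff_eq_self ht
  have hττ : ∀ t, τ (τ t) = t := by
    intro t
    by_cases hk : k₀ ∈ t
    · have h1 : τ t = t.erase k₀ := by simp only [hτ, if_pos hk]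
      rw [h1]
      have h2 : τ (t.erase k₀) = insert k₀ (t.erase k₀) := by simp only [hτ, if_neg (Finset.notMem_erase k₀ t)]
      rw [h2, Finset.insert_erase hk]
    · have h1 : τ t = insert k₀ t := by simp only [hτ, if_neg hk]
      rw [h1]
      have h2 : τ (insert k₀ t) = (insert k₀ t).erase k₀ := by simp only [hτ, if_pos (Finset.mem_insert_self k₀ t)]
      rw [h2, Finset.erase_insert hk]
  have hcsum : ∀ t, t ⊆ S → ∑ k ∈ c t, a k + ∑ k ∈ t, a k = ∑ k ∈ S, a k := fun t ht => Finset.sum_sdiff ht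
  have hak₀ := ha k₀
  -- covering of the power set by four copies of `H`
  have hcover : S.powerset ⊆ H ∪ H.image c ∪ H.image τ ∪ H.image (fun t => τ (c t)) := by
    intro t ht
    rw [Finset.mem_powerset] at ht
    simp only [Finset.mem_union, Finset.mem_image]
    by_cases h1 : y ≤ ∑ k ∈ t, a k
    · exact Or.inl (Or.inl (Or.inl (Finset.mem_filter.2 ⟨Finset.mem_powerset.2 ht, h1⟩)))
    by_cases h2 : y ≤ ∑ k ∈ c t, a k
    · exact Or.inl (Or.inl (Or.inr ⟨c t, Finset.mem_filter.2 ⟨Finset.mem_powerset.2 Finset.sdiff_subset, h2⟩, hcc t ht⟩))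
    have hs := hcsum t ht
    by_cases hk : k₀ ∈ t
    · -- `c (τ t)` is heavy and `t = τ (c (c (τ t)))`
      right
      have hτt : τ t = t.erase k₀ := by simp only [hτ, if_pos hk]
      have hsub : τ t ⊆ S := by rw [hτt]; exact (Finset.erase_subset k₀ t).trans ht
      have he : ∑ k ∈ t.erase k₀, a k + a k₀ = ∑ k ∈ t, a k := Finset.sum_erase_add _ _ hk
      have hs2 := hcsum (τ t) hsub
      rw [hτt] at hs2
      refine ⟨c (τ t), Finset.mem_filter.2 ⟨Finset.mem_powerset.2 Finset.sdiff_subset, ?_⟩, ?_⟩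
      · rw [hτt]
        omega
      · show τ (c (c (τ t))) = t
        rw [hcc _ hsub, hττ]
    · -- `τ t = insert k₀ t` is heavy and `t = τ (τ t)`
      left; right
      have hτt : τ t = insert k₀ t := by simp only [hτ, if_neg hk]
      refine ⟨τ t, Finset.mem_filter.2 ⟨Finset.mem_powerset.2 ?_, ?_⟩, hττ t⟩
      · rw [hτt]
        exact Finset.insert_subset hk₀ ht
      · rw [hτt, Finset.sum_insert hk]
        omega
  calc S.powerset.card ≤ (H ∪ H.image c ∪ H.image τ ∪ H.image (fun t => τ (c t))).card := Finset.card_le_card hcover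
    _ ≤ H.card + H.card + H.card + H.card := by
        refine (Finset.card_union_le _ _).trans (Nat.add_le_add ?_ Finset.card_image_le)
        refine (Finset.card_union_le _ _).trans (Nat.add_le_add ?_ Finset.card_image_le)
        exact (Finset.card_union_le _ _).trans (Nat.add_le_add le_rfl Finset.card_image_le)
    _ = 4 * H.card := by ring

omit [Fintype κ] in
/-- **Reflection count, weighted form.**  With fair coins on `S` (weight `(1/2)^{#S}` per subset), the heavy subsets carry mass `≥ 1/4`
when `∑_{k∈S} a k ≥ 2y − 2`, `y ≥ 2`, sizes `a k ≥ 1`. [this work] -/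
theorem quarter_le_sum_powerset_heavy (S : Finset κ) (a : κ → ℕ) (ha : ∀ k, 1 ≤ a k) (y : ℕ)
    (hA : 2 * y ≤ ∑ k ∈ S, a k + 2) (hy : 2 ≤ y) :
    (1 / 4 : ℝ) ≤ ∑ t ∈ S.powerset, (∏ k ∈ S, if k ∈ t then (1 / 2 : ℝ) else 1 - 1 / 2) *
        (if y ≤ ∑ k ∈ t, a k then (1 : ℝ) else 0) := by
  have hhalf : ∀ t : Finset κ, (∏ k ∈ S, if k ∈ t then (1 / 2 : ℝ) else 1 - 1 / 2) = (1 / 2) ^ S.card := by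
    intro t
    rw [← Finset.prod_const]
    exact Finset.prod_congr rfl fun k _ => by split_ifs <;> norm_num
  simp_rw [hhalf, mul_ite, mul_one, mul_zero]
  rw [← Finset.sum_filter, Finset.sum_const, nsmul_eq_mul]
  have hcard := card_powerset_le_four_mul_card_heavy S a ha y hA hy
  rw [Finset.card_powerset] at hcard
  have hcast : (2 : ℝ) ^ S.card ≤ 4 * ((S.powerset.filter (fun t => y ≤ ∑ k ∈ t, a k)).card : ℝ) := by
    exact_mod_cast hcard
  have hpow : (0 : ℝ) < 2 ^ S.card := by positivity
  rw [div_pow, one_pow, mul_one_div, le_div_iff₀ hpow]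
  linarith

end IndepBlob

end Quant

end Summit.CriticalPhenomena.PercolationContinuityZ3.Theorems
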